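import Summits.CriticalPhenomena.PercolationContinuityZ3.Theorems.PercNearOneGluingNoHeavyLowerTailFloorSplitCILOneLayer
import Summits.CriticalPhenomena.PercolationContinuityZ3.Theorems.PercNearOneGluingNoHeavyLowerTailFloorSplitStarAlgebraPre
import HarnessLib

/-!
# `NoHeavyLowerTail` (stmt-CriticalPhenomena-4575) — the floor-split CIL for one-layer observers, PRE-FKG form (PROVED)

Lemma factory #5 (`prim-lf-5`, gen 12; memo `run/shared/lean/prim/prim-lf-5/PRE-FSCIL.md`).
`--supports stmt-CriticalPhenomena-4575`.  No definitions, no named facts, no sorries.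

Notation: `μ = prodBernoulli w`, relays `A`, one-layer observer `o ∉ A` (`w s(o,u) = 0` for `u ∉ A`, `u ≠ o`),
`N = |{x ∈ A : o ↔ x}|`, `N_a = |{x ∈ A : a ↔ x}|`, `u = μ(o ↔ A)`, Kozma–Nitzan's singleton ratios
`φ_a = μ(o ↔ a, N_a = 1)/μ(N_a = 1)`, `σ' = u − Σ_a φ_a`, and the JOINT lightness `S_a = μ(o ↔ A, N_a ≤ j)`.

**Theorem (`floorSplitCIL_oneLayer_pre`).**  If `c₀ ∈ A` is lightest off the observer
(`μ(|{x ∈ A : a ↔ x off o}| ≤ j) ≤ μ(|{x ∈ A : c₀ ↔ x off o}| ≤ j)` for all `a ∈ A`), then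

  `u · μ(1 ≤ N ≤ j) ≤ Σ_{a∈A} φ_a · S_a + σ' · S_{c₀}`,

i.e. `μ(N ≤ j | o ↔ A) ≤ Σ_a (φ_a/u) μ(N_a ≤ j | o ↔ A) + (σ'/u) μ(N_{c₀} ≤ j | o ↔ A)`: GIVEN that the observer reaches
the relays, its relay count is stochastically larger (at level `j`) than that of a relay drawn from the probability vector
`(φ + σ'δ_{c₀})/u` — a "pre-FKG" inequality in the sense of Kozma–Nitzan (arXiv:2401.12397, Conjecture 2 vs 1; the
coefficient shape of their Question 5).  By Harris (`μ(o ↔ A, N_a > j) ≥ u·μ(N_a > j)`) it implies the floor-split CIL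
`floorSplitCIL_oneLayer_Hwitness` (gen 10), and it is strictly stronger (it has content already at `j = 1`).

Proof: the star decomposition of gen 10 (`…FloorSplitOneLayerStars/Sums/Rows`) feeds the PRE-FKG star algebra
`FloorSplitOneLayer.starAlgebra_pre` (the gen-10 algebra applied to the star law conditioned on `{o ↔ A}`); the only
new probabilistic input is the star sum of the joint lightness, `real_obsConn_light_eq_sum`.
-/

noncomputable section

namespace Summit.CriticalPhenomena.PercolationContinuityZ3.Theorems

open MeasureTheory Set Literature.Probability.LatticeModels Literature.Probability.Percolation
open Literature.Probability.Percolation.KNPreFKG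
open scoped Classical

variable {V : Type*} [Fintype V]

namespace FloorSplitOneLayer

/-- **The joint lightness of a relay as a star sum**: for a one-layer observer `o ∉ A` and `v ∈ A`,
`μ(o ↔ A, N_v ≤ j) = Σ_{∅ ≠ B ⊆ A} μ(σ_B)·(μ(E^U_B) if v ∈ B, else μ(E^small_v ∩ E^nc_{v,B}) + μ(E^U_B ∩ E^conn_{v,B}))`:
under `σ_B` with `B ≠ ∅` the observer reaches `B ⊆ A`, under `σ_∅` it reaches nothing, and the terms are those of
`real_light_eq_sum`. [this work] -/
theorem real_obsConn_light_eq_sum (w : Sym2 V → unitInterval) (A : Finset V) {o : V} (ho : o ∉ A)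
    (hiso : ∀ u, u ≠ o → u ∉ A → w s(o, u) = 0) (j : ℕ) {v : V} (hvA : v ∈ A) :
    (prodBernoulli w).real ((⋃ a ∈ A, (openConn o a : Set (BondConfig V))) ∩
        {ω : BondConfig V | (A.filter fun x => ω ∈ openConn v x).card ≤ j}) =
      ∑ B ∈ A.powerset.filter (fun B => B.Nonempty), (prodBernoulli w).real (starEvent o (↑B : Set V)) *
        (if v ∈ B then
          (prodBernoulli w).real {ω : BondConfig V |
            (A.filter fun x => ∃ u ∈ B, ω ∈ openConnIn {o}ᶜ u x).card ≤ j}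
        else
          ((prodBernoulli w).real ({ω : BondConfig V |
              (A.filter fun x => ω ∈ openConnIn {o}ᶜ v x).card ≤ j} ∩ {ω | ∀ u ∈ B, ω ∉ openConnIn {o}ᶜ v u}) +
           (prodBernoulli w).real ({ω : BondConfig V |
              (A.filter fun x => ∃ u ∈ B, ω ∈ openConnIn {o}ᶜ u x).card ≤ j} ∩
             {ω | ∃ u ∈ B, ω ∈ openConnIn {o}ᶜ v u}))) := by
  set X : Set (BondConfig V) := ⋃ a ∈ A, (openConn o a : Set (BondConfig V)) with hX
  set L : Set (BondConfig V) := {ω | (A.filter fun x => ω ∈ openConn v x).card ≤ j} with hL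
  rw [real_eq_sum_inter_starEvent w A o ho hiso (X ∩ L), Finset.sum_filter]
  refine Finset.sum_congr rfl fun B hB => ?_
  have hBA : B ⊆ A := Finset.mem_powerset.1 hB
  split_ifs with hne hvB
  · -- `B ≠ ∅`, `v ∈ B`: `σ_B ⊆ {o ↔ A}`
    have hset : X ∩ L ∩ starEvent o (↑B : Set V) = L ∩ starEvent o (↑B : Set V) := by
      ext ω
      simp only [mem_inter_iff]
      constructor
      · rintro ⟨⟨_, hl⟩, hσ⟩; exact ⟨hl, hσ⟩
      · rintro ⟨hl, hσ⟩
        obtain ⟨b, hb⟩ := hne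
        have hbo : b ≠ o := fun h => ho (h ▸ hBA hb)
        have hob : s(o, b) ∈ ω := ((mem_starEvent_iff o (↑B) ω).1 hσ b hbo).2 hb
        exact ⟨⟨mem_iUnion₂.2 ⟨b, hBA hb, ((openGraph_adj ω o b).2 ⟨hob, hbo.symm⟩).reachable⟩, hl⟩, hσ⟩
    rw [hset]
    exact real_light_inter_starEvent_of_mem w A ho j hBA hvB
  · -- `B ≠ ∅`, `v ∉ B`
    have hset : X ∩ L ∩ starEvent o (↑B : Set V) = L ∩ starEvent o (↑B : Set V) := by
      ext ω
      simp only [mem_inter_iff]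
      constructor
      · rintro ⟨⟨_, hl⟩, hσ⟩; exact ⟨hl, hσ⟩
      · rintro ⟨hl, hσ⟩
        obtain ⟨b, hb⟩ := hne
        have hbo : b ≠ o := fun h => ho (h ▸ hBA hb)
        have hob : s(o, b) ∈ ω := ((mem_starEvent_iff o (↑B) ω).1 hσ b hbo).2 hb
        exact ⟨⟨mem_iUnion₂.2 ⟨b, hBA hb, ((openGraph_adj ω o b).2 ⟨hob, hbo.symm⟩).reachable⟩, hl⟩, hσ⟩
    rw [hset]
    exact real_light_inter_starEvent_of_not_mem w A ho j hBA hvA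
  · -- `B = ∅`: the observer is isolated
    rw [Finset.not_nonempty_iff_eq_empty] at hne
    subst hne
    have h0 : X ∩ L ∩ starEvent o (↑(∅ : Finset V) : Set V) = ∅ := by
      ext ω
      simp only [mem_inter_iff, mem_empty_iff_false, iff_false, not_and]
      rintro ⟨hx, _⟩ hσ
      rw [Finset.coe_empty] at hσ
      obtain ⟨a, ha, hoa⟩ : ∃ a ∈ A, ω ∈ (openConn o a : Set (BondConfig V)) := by
        simpa only [hX, mem_iUnion, exists_prop] using hx
      exact not_reachable_of_mem_starEvent_empty hσ (fun h => ho (h ▸ ha)) hoa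
    rw [h0, measureReal_empty]

end FloorSplitOneLayer

/-- **The floor-split cumulative isolation lemma for one-layer observers, pre-FKG form.**  If `o ∉ A` is a one-layer
observer (`w s(o,u) = 0` for `u ∉ A`, `u ≠ o`) and `c₀ ∈ A` is lightest off the observer
(`μ(|{x ∈ A : a ↔ x off o}| ≤ j) ≤ μ(|{x ∈ A : c₀ ↔ x off o}| ≤ j)` for all `a ∈ A`), then with `u = μ(o ↔ A)` and
`φ_a = μ(o ↔ a, N_a = 1)/μ(N_a = 1)`:
`u·μ(1 ≤ N ≤ j) ≤ Σ_a φ_a μ(o ↔ A, N_a ≤ j) + (u − Σ_a φ_a)·μ(o ↔ A, N_{c₀} ≤ j)`.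
[this work; cite: KozmaNitzan2024, Thm. 8 (p. 32), Lemma 3 (pp. 6–7), Lemma 5 (p. 13), Question 5 (p. 32)] -/
theorem floorSplitCIL_oneLayer_pre (w : Sym2 V → unitInterval) (A : Finset V) (o : V) (j : ℕ) (ho : o ∉ A)
    (hiso : ∀ u, u ≠ o → u ∉ A → w s(o, u) = 0) (c₀ : V) (hc₀A : c₀ ∈ A)
    (hc₀max : ∀ a ∈ A,
      (prodBernoulli w).real {ω : BondConfig V | (A.filter fun x => ω ∈ openConnIn {o}ᶜ a x).card ≤ j} ≤
        (prodBernoulli w).real {ω : BondConfig V | (A.filter fun x => ω ∈ openConnIn {o}ᶜ c₀ x).card ≤ j}) :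
    (prodBernoulli w).real (⋃ a ∈ A, (openConn o a : Set (BondConfig V))) *
        (prodBernoulli w).real {ω : BondConfig V |
          1 ≤ (A.filter fun x => ω ∈ openConn o x).card ∧ (A.filter fun x => ω ∈ openConn o x).card ≤ j} ≤
      (∑ a ∈ A,
          (prodBernoulli w).real ((openConn o a : Set (BondConfig V)) ∩
              {ω | (A.filter fun x => ω ∈ openConn a x).card = 1}) /
            (prodBernoulli w).real {ω : BondConfig V | (A.filter fun x => ω ∈ openConn a x).card = 1} *
          (prodBernoulli w).real ((⋃ a' ∈ A, (openConn o a' : Set (BondConfig V))) ∩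
            {ω : BondConfig V | (A.filter fun x => ω ∈ openConn a x).card ≤ j})) +
        ((prodBernoulli w).real (⋃ a ∈ A, (openConn o a : Set (BondConfig V))) -
            ∑ a ∈ A,
              (prodBernoulli w).real ((openConn o a : Set (BondConfig V)) ∩
                  {ω | (A.filter fun x => ω ∈ openConn a x).card = 1}) /
                (prodBernoulli w).real {ω : BondConfig V | (A.filter fun x => ω ∈ openConn a x).card = 1}) *
          (prodBernoulli w).real ((⋃ a' ∈ A, (openConn o a' : Set (BondConfig V))) ∩
            {ω : BondConfig V | (A.filter fun x => ω ∈ openConn c₀ x).card ≤ j}) := by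
  set μ := prodBernoulli w with hμ
  -- the abstract star data
  set wB : Finset V → ℝ := fun B => μ.real (starEvent o (↑B : Set V)) with hwB
  set q : V → ℝ := fun v => μ.real {ω : BondConfig V | (A.filter fun x => ω ∈ openConnIn {o}ᶜ v x).card ≤ j}
    with hq
  set r : Finset V → ℝ := fun B =>
    μ.real {ω : BondConfig V | (A.filter fun x => ∃ u ∈ B, ω ∈ openConnIn {o}ᶜ u x).card ≤ j} with hr
  set n : V → Finset V → ℝ := fun v B =>
    μ.real ({ω : BondConfig V | (A.filter fun x => ω ∈ openConnIn {o}ᶜ v x).card ≤ j} ∩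
        {ω | ∀ u ∈ B, ω ∉ openConnIn {o}ᶜ v u}) +
      μ.real ({ω : BondConfig V | (A.filter fun x => ∃ u ∈ B, ω ∈ openConnIn {o}ᶜ u x).card ≤ j} ∩
        {ω | ∃ u ∈ B, ω ∈ openConnIn {o}ᶜ v u}) with hn
  set φ : V → ℝ := fun a =>
    μ.real ((openConn o a : Set (BondConfig V)) ∩ {ω | (A.filter fun x => ω ∈ openConn a x).card = 1}) /
      μ.real {ω : BondConfig V | (A.filter fun x => ω ∈ openConn a x).card = 1} with hφ
  set S : V → ℝ := fun v => μ.real ((⋃ a' ∈ A, (openConn o a' : Set (BondConfig V))) ∩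
      {ω : BondConfig V | (A.filter fun x => ω ∈ openConn v x).card ≤ j}) with hS
  have hc₀max' : ∀ a ∈ A, q a ≤ q c₀ := fun a ha => hc₀max a ha
  have hc₀o : c₀ ≠ o := fun h => ho (h ▸ hc₀A)
  -- hypotheses of the star algebra (as in `floorSplitCIL_oneLayer_Hwitness`)
  have hw0 : ∀ B ∈ A.powerset, 0 ≤ wB B := fun B _ => measureReal_nonneg
  have hw1 : ∑ B ∈ A.powerset, wB B = 1 := FloorSplitOneLayer.sum_real_starEvent_eq_one w A o ho hiso
  have hr1 : ∀ a ∈ A, r {a} = q a := by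
    intro a _
    simp only [hr, hq, FloorSplitOneLayer.usmall_singleton_eq]
  have hn1 : ∀ v ∈ A, ∀ B ∈ A.powerset, B.card ≤ 1 → v ∉ B → n v B = q v := by
    intro v _ B _ hcard _
    rcases Nat.le_one_iff_eq_zero_or_eq_one.1 hcard with h0 | h1
    · rw [Finset.card_eq_zero] at h0
      subst h0
      exact FloorSplitOneLayer.n_empty_eq w A o j v
    · obtain ⟨b, rfl⟩ := Finset.card_eq_one.1 h1
      exact FloorSplitOneLayer.n_singleton_eq w A o j v b
  have hrow0 : ∀ B ∈ A.powerset, B.Nonempty → r B ≤ q c₀ := by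
    intro B hB ⟨b, hb⟩
    exact (FloorSplitOneLayer.real_usmall_le_small w A o j hb).trans (hc₀max' b (Finset.mem_powerset.1 hB hb))
  have hrow : ∀ B ∈ A.powerset, 2 ≤ B.card → ∀ v ∈ A, v ∉ B → r B + q v - n v B ≤ q c₀ := by
    intro B hB _ v hvA _
    have hBA : B ⊆ A := Finset.mem_powerset.1 hB
    have hB' : ∀ u ∈ B, u ≠ o := fun u hu h => ho (h ▸ hBA hu)
    have hvo : v ≠ o := fun h => ho (h ▸ hvA)
    have hBne : B.Nonempty := Finset.card_pos.1 (by omega)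
    obtain ⟨b, hb⟩ := hBne
    have e := FloorSplitOneLayer.row_quantity_eq w A o j v B
    have t := FloorSplitOneLayer.starRow_transfer w A j hB' hc₀o hvo (hc₀max' v hvA) ⟨b, hb, hc₀max' b (hBA hb)⟩
    simp only [hr, hq, hn]
    rw [e]
    exact t
  have hφ0 : ∀ a ∈ A, 0 ≤ φ a := fun a _ => div_nonneg measureReal_nonneg measureReal_nonneg
  have hφ1 : ∀ a ∈ A, φ a ≤ wB {a} / (wB {a} + ∑ B ∈ A.powerset.filter (fun B => a ∉ B), wB B) :=
    fun a ha => FloorSplitOneLayer.phi_le w A ho hiso ha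
  -- the pre-FKG star algebra for the witness `c₀`
  have key := FloorSplitOneLayer.starAlgebra_pre A c₀ hc₀A wB q r n φ hw0 hw1 hr1 hn1
    hc₀max' hrow0 hrow hφ0 hφ1
  -- read the abstract sums as probabilities
  have hbad : μ.real {ω : BondConfig V | 1 ≤ (A.filter fun x => ω ∈ openConn o x).card ∧
      (A.filter fun x => ω ∈ openConn o x).card ≤ j} =
      ∑ B ∈ A.powerset.filter (fun B => B.Nonempty), wB B * r B :=
    FloorSplitOneLayer.real_bad_eq_sum w A ho hiso j
  have hSv : ∀ v ∈ A, ∑ B ∈ A.powerset.filter (fun B => B.Nonempty), wB B * (if v ∈ B then r B else n v B) =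
      S v := by
    intro v hvA
    simp only [hS]
    rw [FloorSplitOneLayer.real_obsConn_light_eq_sum w A ho hiso j hvA]
  have hPoA : ∑ B ∈ A.powerset.filter (fun B => B.Nonempty), wB B =
      μ.real (⋃ a ∈ A, (openConn o a : Set (BondConfig V))) :=
    (FloorSplitOneLayer.real_obsConn_eq_sum w A o ho hiso).symm
  have hsumS : ∑ a ∈ A, φ a * ∑ B ∈ A.powerset.filter (fun B => B.Nonempty), wB B * (if a ∈ B then r B else n a B) =
      ∑ a ∈ A, φ a * S a :=
    Finset.sum_congr rfl fun a ha => by rw [hSv a ha]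
  rw [hbad, ← hPoA]
  refine key.trans ?_
  rw [hsumS, hSv c₀ hc₀A]

end Summit.CriticalPhenomena.PercolationContinuityZ3.Theorems

end
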